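import Literature.Probability.Percolation.FourFunctionsProdBernoulli
import HarnessLib

/-!
# The cluster-merge inequality for three vertices (an Ahlswede–Daykin corollary)

Topic `Literature/Probability/Percolation`.  Bond percolation `μ = prodBernoulli w` with arbitrary edge
probabilities on a finite vertex type, three vertices `s, y, z`, and `P(π)` the probability that the open
clusters induce the partition `π` of `{s, y, z}` (`sy|z` = "`s ↔ y`, `z` apart", `s|y|z` = pairwise apart,
`syz` = all joined).  Then

  `P(sy|z) · [P(sz|y) + P(yz|s)] ≤ P(syz) · P(s|y|z)`,                                   (merge)

equivalently `P(s ↔ z | s ↔ y) ≥ P(z ↔ s or z ↔ y | s ↮ y)`: the vertex `z` joins the MERGED pair at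
least as easily as it joins one of the two SEPARATED vertices.  Proof: a configuration of the cell
`sy|z` and a configuration of `{s ↮ y, z ↔ s or z ↔ y}` UNITE in a configuration where `s, y, z` are all
joined and INTERSECT in one where they are pairwise separated (if `y ↔ z` survived in the intersection,
then `s ↔ y ↔ z` in the first configuration, contradicting `s ↮ z` there), so this is the four-events form
of the Ahlswede–Daykin four functions theorem for the log-modular product measure
(`prodBernoulli_fourEvents`, Bollobás–Riordan Ch. 2 Thm. 7 / eq. (14)), exactly as for `crossingSplits`.
The same argument carries an arbitrary INCREASING event `B` on the `sy|z` factor and the `syz` factor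
(`clusterMerge_mono`): `μ(B ∩ sy|z) · μ(s ↮ y, z ↔ {s,y}) ≤ μ(B ∩ syz) · μ(s|y|z)`.

These are the proved base rows ("MERGE", "AD1 with a monotone weight") of the best-member /
set-gluing inequalities studied on the `NoHeavyLowerTail` line of stmt-CriticalPhenomena-4575
(prover memo `prim-hp-8/PROOF-HEART.md` §4d); no definition and no named fact is introduced.

## References

* B. Bollobás, O. Riordan, *Percolation*, Cambridge University Press 2006, Ch. 2, Theorem 7 (Four
  Functions Theorem) and eq. (14). [BollobasRiordan2006]
* R. Ahlswede, D. E. Daykin, *An inequality for the weights of two families of sets, their unions and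
  intersections*, Z. Wahrsch. Verw. Gebiete 43 (1978) 183–185. [AhlswedeDaykin1978]
-/

noncomputable section

open MeasureTheory Set
open Literature.Probability.LatticeModels (prodBernoulli)

namespace Literature.Probability.Percolation

variable {V : Type*}

/-- **Cluster-merge inequality with a monotone weight.**  Bond percolation `μ = prodBernoulli w` on a
finite vertex type, vertices `s, y, z`, and an increasing event `B` (closed under enlarging the
configuration).  Then
`μ(B ∩ {s↔y} ∩ {s↮z}) · μ({s↮y} ∩ ({s↔z} ∪ {y↔z})) ≤ μ(B ∩ {s↔y} ∩ {s↔z}) · μ({s↮y} ∩ {s↮z} ∩ {y↮z})`: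
a configuration `a` of the first event and `b` of the second unite in `a ∪ b ∈ B ∩ {s↔y↔z}` (`B` is
increasing, `s ↔ y` from `a`, and `z` reaches `s` or `y` already in `b`) and meet in `a ∩ b` with `s, y, z`
pairwise separated (`s ↮ y` from `b`, `s ↮ z` from `a`, and `y ↔ z` in `a ∩ b` would give `s ↔ y ↔ z` in
`a`).  Four-events form of Ahlswede–Daykin for the product measure (`prodBernoulli_fourEvents`).
[cite: BollobasRiordan2006, Ch. 2 Thm. 7 and eq. (14) — corollary, derived in this file; AhlswedeDaykin1978] -/
theorem clusterMerge_mono [Fintype V] (w : Sym2 V → unitInterval) (s y z : V)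
    (B : Set (BondConfig V)) (hB : ∀ ⦃a b : BondConfig V⦄, a ∈ B → a ⊆ b → b ∈ B) :
    (prodBernoulli w).real (B ∩ openConn s y ∩ (openConn s z)ᶜ) *
        (prodBernoulli w).real ((openConn s y)ᶜ ∩ (openConn s z ∪ openConn y z)) ≤
      (prodBernoulli w).real (B ∩ openConn s y ∩ openConn s z) *
        (prodBernoulli w).real ((openConn s y)ᶜ ∩ (openConn s z)ᶜ ∩ (openConn y z)ᶜ) := by
  rw [mul_comm ((prodBernoulli w).real (B ∩ openConn s y ∩ openConn s z))]
  refine prodBernoulli_fourEvents w _ _ _ _ fun a ha b hb => ?_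
  have openGraph_le : ∀ {ω ω' : BondConfig V}, ω ⊆ ω' → openGraph ω ≤ openGraph ω' :=
    fun h => BHK2006.openGraph_le h
  have mem : ∀ (ω : BondConfig V) (u v : V),
      ω ∈ (openConn u v : Set (BondConfig V)) ↔ (openGraph ω).Reachable u v := fun _ _ _ => Iff.rfl
  simp only [mem_inter_iff, mem_compl_iff, mem_union, mem] at ha hb ⊢
  obtain ⟨⟨haB, hsy⟩, hsz⟩ := ha
  obtain ⟨hsy', hz⟩ := hb
  have hla : openGraph (a ∩ b) ≤ openGraph a := openGraph_le inter_subset_left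
  have hlb : openGraph (a ∩ b) ≤ openGraph b := openGraph_le inter_subset_right
  have hua : openGraph a ≤ openGraph (a ∪ b) := openGraph_le subset_union_left
  have hub : openGraph b ≤ openGraph (a ∪ b) := openGraph_le subset_union_right
  refine ⟨⟨⟨fun h => hsy' (h.mono hlb), fun h => hsz (h.mono hla)⟩,
      fun h => hsz (hsy.trans (h.mono hla))⟩, ⟨hB haB subset_union_left, hsy.mono hua⟩, ?_⟩
  rcases hz with hz | hz
  · exact hz.mono hub
  · exact (hsy.mono hua).trans (hz.mono hub)

/-- **Cluster-merge inequality** ("`z` joins the merged pair at least as easily as one of the separated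
vertices").  Bond percolation `μ = prodBernoulli w` on a finite vertex type, vertices `s, y, z`:
`μ({s↔y} ∩ {s↮z}) · μ({s↮y} ∩ ({s↔z} ∪ {y↔z})) ≤ μ({s↔y} ∩ {s↔z}) · μ({s↮y} ∩ {s↮z} ∩ {y↮z})`, i.e.
`P(sy|z) · [P(sz|y) + P(yz|s)] ≤ P(syz) · P(s|y|z)`, equivalently
`P(s ↔ z | s ↔ y) ≥ P(z ↔ s or z ↔ y | s ↮ y)`.  The case `B = univ` of `clusterMerge_mono`.
[cite: BollobasRiordan2006, Ch. 2 Thm. 7 and eq. (14) — corollary, derived in this file; AhlswedeDaykin1978] -/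
theorem clusterMerge [Fintype V] (w : Sym2 V → unitInterval) (s y z : V) :
    (prodBernoulli w).real (openConn s y ∩ (openConn s z)ᶜ) *
        (prodBernoulli w).real ((openConn s y)ᶜ ∩ (openConn s z ∪ openConn y z)) ≤
      (prodBernoulli w).real (openConn s y ∩ openConn s z) *
        (prodBernoulli w).real ((openConn s y)ᶜ ∩ (openConn s z)ᶜ ∩ (openConn y z)ᶜ) := by
  have h := clusterMerge_mono w s y z Set.univ fun _ _ _ _ => mem_univ _
  simpa only [univ_inter] using h

end Literature.Probability.Percolation

end
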